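import Summits.CriticalPhenomena.PercolationContinuityZ3.Theorems.PercNearOneGluingNoHeavyLowerTailSunflowerTwoCoinPairwise

/-!
# (RES0′) for every number of petals on pairwise-compatible families (model form of THEOREM Y)

Model (prove-1 g52 §0): parameters `τ ∈ (0,1)`, `σ ∈ [0,1)`, `s ∈ (0,1]`, floors `0 < α₀₀ ≤ α₀₁ ≤ α₁₁`, ANY constant `c₀ ≥ 0`,
`p = τ(1−σ)`, `q = s(1−τ)`, `b_Ȳ = (1−s)α₀₀ + sα₀₁`, `b_H = (1−σ)α₀₁ + σα₁₁`, `g = c₀ + p b_Ȳ + q b_H`; petals with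
`Ȳ_j = (1−s)y_j + s k_j ≥ b_Ȳ`, `H_j = (1−σ)g_j + σh_j ≥ b_H` (floors only: no caps, no links are used), `G_j = c₀ + pȲ_j + qH_j`.
Two petals are (two-coin) COMPATIBLE if `(pΔȲ_i + qΔH_i)(pΔȲ_j + qΔH_j) ≤ g·(pΔȲ_iΔȲ_j/b_Ȳ + qΔH_iΔH_j/b_H)`
(`ΔȲ = Ȳ − b_Ȳ`, `ΔH = H − b_H`); a petal is H-DOMINANT (not Ȳ-heavy) if `p b_H ΔȲ_j ≤ (c₀ + p b_Ȳ) ΔH_j`.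

* `res0_pairwise`: every pairwise-compatible family satisfies `∏ G_j ≤ g^(|S|−1)(c₀ + p + q)` under the two FACE budgets
  `∏Ȳ_j ≤ b_Ȳ^(|S|−1)`, `∏H_j ≤ b_H^(|S|−1)` — every `n`, any `c₀ ≥ 0`, no cell budget, no leaf-leaf constant.
* `res0_Hdominant`: in particular every family of H-dominant petals (h-petals, leverage dwarfs, diagonal petals, H-hubs, full
  petals when `p(1−b_Ȳ)b_H ≤ (c₀+pb_Ȳ)(1−b_H)`, … in any mixture: the F1-type families of gen 54 that need the H-face branch).
Complementary to `res0_classK` (K-dominant petals, Ȳ-cover). [this work]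
-/

namespace Summit.CriticalPhenomena.PercolationContinuityZ3.Theorems.SunflowerPartition.SafeCalc.LinkedCurrency

open Finset

/-- **H-dominant petals are pairwise compatible.**  With `Q_Y = 1/ε_Y − 1`, `Q_H = 1/ε_H − 1` (`Q_YQ_H ≥ 1` as `ε_Y + ε_H ≤ 1`):
if `a_i ≤ Q_H b_i` and `a_j ≤ Q_H b_j` then `(a_i+b_i)(a_j+b_j) ≤ a_ia_j/ε_Y + b_ib_j/ε_H`, because
`Q_H·(Q_Ya_ia_j + Q_Hb_ib_j − a_ib_j − a_jb_i) ≥ (Q_Hb_i − a_i)(Q_Hb_j − a_j) ≥ 0`. [this work] -/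
theorem compat_of_Hdominant {εY εH ai bi aj bj : ℝ} (hY : 0 < εY) (hH : 0 < εH) (hsum : εY + εH ≤ 1)
    (hai : 0 ≤ ai) (haj : 0 ≤ aj)
    (hi : εH * ai ≤ (1 - εH) * bi) (hj : εH * aj ≤ (1 - εH) * bj) :
    (ai + bi) * (aj + bj) ≤ ai * aj / εY + bi * bj / εH := by
  rw [div_add_div _ _ hY.ne' hH.ne', le_div_iff₀ (mul_pos hY hH)]
  -- εH² · [ai aj εH + bi bj εY − (ai+bi)(aj+bj) εY εH] ≥ εY · ((1−εH)bi − εH ai)((1−εH)bj − εH aj) ≥ 0  (times suitable factors)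
  have h1 : 0 ≤ ((1 - εH) * bi - εH * ai) * ((1 - εH) * bj - εH * aj) := mul_nonneg (by linarith) (by linarith)
  have hc : 0 ≤ 1 - εY - εH := by linarith
  have hbi : 0 ≤ bi := by nlinarith [mul_nonneg hH.le hai]
  have hbj : 0 ≤ bj := by nlinarith [mul_nonneg hH.le haj]
  -- key identity (multiply target by εH): εH(ai aj εH + bi bj εY) - εH εY εH (ai+bi)(aj+bj)
  --   = εY ((1-εH)bi - εH ai)((1-εH)bj - εH aj) + (1 - εY - εH) εH (ai aj εH ... )  -- we let nlinarith find it
  nlinarith [mul_nonneg hY.le h1, mul_nonneg (mul_nonneg hc hH.le) (mul_nonneg hai haj),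
    mul_nonneg (mul_nonneg hc hY.le) (mul_nonneg hbi hbj), mul_nonneg hai hbj, mul_nonneg haj hbi,
    mul_nonneg (mul_nonneg hH.le hH.le) (mul_nonneg hai haj)]

set_option maxHeartbeats 400000 in
/-- **(RES0′) FOR EVERY NUMBER OF PETALS ON PAIRWISE-COMPATIBLE FAMILIES** (model form of `two_coin_pairwise_family_le`).
See the module docstring for the setting; hypotheses: floors `Ȳ_j ≥ b_Ȳ`-generating (`α₀₀ ≤ y_j`, `α₀₁ ≤ k_j`), `α₀₁ ≤ g_j`,
`α₁₁ ≤ h_j`, pairwise compatibility, and the two face budgets.  Then `∏ G_j ≤ g^(|S|−1)·(c₀ + p + q)`. [this work] -/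
theorem res0_pairwise {κ : Type*} [DecidableEq κ] {τ σ s α00 α01 α11 c0 : ℝ} (hτ0 : 0 < τ) (hτ1 : τ < 1)
    (hσ0 : 0 ≤ σ) (hσ1 : σ < 1) (hs0 : 0 < s) (hs1 : s ≤ 1) (hα00 : 0 < α00) (h01 : α00 ≤ α01) (h11 : α01 ≤ α11) (hc0 : 0 ≤ c0)
    (S : Finset κ) (hS : S.Nonempty) (y k gc h : κ → ℝ)
    (hy : ∀ j ∈ S, α00 ≤ y j) (hk : ∀ j ∈ S, α01 ≤ k j) (hg : ∀ j ∈ S, α01 ≤ gc j) (hh : ∀ j ∈ S, α11 ≤ h j)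
    (hcompat : ∀ i ∈ S, ∀ j ∈ S, i ≠ j →
      (τ * (1 - σ) * ((1 - s) * y i + s * k i - ((1 - s) * α00 + s * α01)) +
          s * (1 - τ) * ((1 - σ) * gc i + σ * h i - ((1 - σ) * α01 + σ * α11))) *
        (τ * (1 - σ) * ((1 - s) * y j + s * k j - ((1 - s) * α00 + s * α01)) +
          s * (1 - τ) * ((1 - σ) * gc j + σ * h j - ((1 - σ) * α01 + σ * α11))) ≤
      (c0 + τ * (1 - σ) * ((1 - s) * α00 + s * α01) + s * (1 - τ) * ((1 - σ) * α01 + σ * α11)) *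
        (τ * (1 - σ) * (((1 - s) * y i + s * k i - ((1 - s) * α00 + s * α01)) *
            ((1 - s) * y j + s * k j - ((1 - s) * α00 + s * α01))) / ((1 - s) * α00 + s * α01) +
          s * (1 - τ) * (((1 - σ) * gc i + σ * h i - ((1 - σ) * α01 + σ * α11)) *
            ((1 - σ) * gc j + σ * h j - ((1 - σ) * α01 + σ * α11))) / ((1 - σ) * α01 + σ * α11)))
    (hBY : ∏ j ∈ S, ((1 - s) * y j + s * k j) ≤ ((1 - s) * α00 + s * α01) ^ (S.card - 1))
    (hBH : ∏ j ∈ S, ((1 - σ) * gc j + σ * h j) ≤ ((1 - σ) * α01 + σ * α11) ^ (S.card - 1)) :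
    ∏ j ∈ S, (c0 + τ * (1 - σ) * ((1 - s) * y j + s * k j) + s * (1 - τ) * ((1 - σ) * gc j + σ * h j)) ≤
      (c0 + τ * (1 - σ) * ((1 - s) * α00 + s * α01) + s * (1 - τ) * ((1 - σ) * α01 + σ * α11)) ^ (S.card - 1) *
        (c0 + τ * (1 - σ) + s * (1 - τ)) := by
  have hα01 : 0 < α01 := lt_of_lt_of_le hα00 h01
  have hα11 : 0 < α11 := lt_of_lt_of_le hα01 h11
  have hp0 : 0 < τ * (1 - σ) := mul_pos hτ0 (by linarith)
  have hq0 : 0 < s * (1 - τ) := mul_pos hs0 (by linarith)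
  have hbY0 : 0 < (1 - s) * α00 + s * α01 := by nlinarith [mul_nonneg (sub_nonneg.2 hs1) hα00.le, mul_pos hs0 hα01]
  have hbH0 : 0 < (1 - σ) * α01 + σ * α11 := by nlinarith [mul_pos (sub_pos.2 hσ1) hα01, mul_nonneg hσ0 hα11.le]
  obtain ⟨bY, hbY⟩ : ∃ b, b = (1 - s) * α00 + s * α01 := ⟨_, rfl⟩
  obtain ⟨bH, hbH⟩ : ∃ b, b = (1 - σ) * α01 + σ * α11 := ⟨_, rfl⟩
  rw [← hbY] at hBY hbY0 hcompat ⊢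
  rw [← hbH] at hBH hbH0 hcompat ⊢
  obtain ⟨p, hp⟩ : ∃ t, t = τ * (1 - σ) := ⟨_, rfl⟩
  obtain ⟨q, hq⟩ : ∃ t, t = s * (1 - τ) := ⟨_, rfl⟩
  rw [← hp] at hp0 hcompat ⊢
  rw [← hq] at hq0 hcompat ⊢
  obtain ⟨g, hgdef⟩ : ∃ t, t = c0 + p * bY + q * bH := ⟨_, rfl⟩
  rw [← hgdef] at hcompat ⊢
  have hgpos : 0 < g := by rw [hgdef]; nlinarith [mul_pos hp0 hbY0, mul_pos hq0 hbH0]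
  obtain ⟨n, hn⟩ : ∃ n, n = S.card := ⟨_, rfl⟩
  have hn1 : 1 ≤ n := by rw [hn]; exact Finset.card_pos.2 hS
  rw [← hn] at hBY hBH ⊢
  have hcardS : S.card = n := hn.symm
  -- faces, excesses, masses
  set Yb : κ → ℝ := fun j => (1 - s) * y j + s * k j with hYb
  set Hf : κ → ℝ := fun j => (1 - σ) * gc j + σ * h j with hHf
  have hYb1 : ∀ j ∈ S, bY ≤ Yb j := fun j hj => by
    simp only [hYb, hbY]; nlinarith [mul_le_mul_of_nonneg_left (hy j hj) (sub_nonneg.2 hs1), mul_le_mul_of_nonneg_left (hk j hj) hs0.le]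
  have hHf1 : ∀ j ∈ S, bH ≤ Hf j := fun j hj => by
    simp only [hHf, hbH]; nlinarith [mul_le_mul_of_nonneg_left (hg j hj) (sub_nonneg.2 hσ1.le), mul_le_mul_of_nonneg_left (hh j hj) hσ0]
  obtain ⟨εY, hεY⟩ : ∃ t, t = p * bY / g := ⟨_, rfl⟩
  obtain ⟨εH, hεH⟩ : ∃ t, t = q * bH / g := ⟨_, rfl⟩
  have hεY0 : 0 < εY := by rw [hεY]; exact div_pos (mul_pos hp0 hbY0) hgpos
  have hεH0 : 0 < εH := by rw [hεH]; exact div_pos (mul_pos hq0 hbH0) hgpos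
  have hεsum : εY + εH ≤ 1 := by
    rw [hεY, hεH, ← add_div, div_le_one hgpos, hgdef]; linarith
  set a : κ → ℝ := fun j => p * (Yb j - bY) / g with ha
  set b : κ → ℝ := fun j => q * (Hf j - bH) / g with hb
  have ha0 : ∀ j ∈ S, 0 ≤ a j := fun j hj => by simp only [ha]; exact div_nonneg (mul_nonneg hp0.le (by linarith [hYb1 j hj])) hgpos.le
  have hb0 : ∀ j ∈ S, 0 ≤ b j := fun j hj => by simp only [hb]; exact div_nonneg (mul_nonneg hq0.le (by linarith [hHf1 j hj])) hgpos.le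
  -- the abstract compatibility hypothesis
  have hcompat' : ∀ i ∈ S, ∀ j ∈ S, i ≠ j → (a i + b i) * (a j + b j) ≤ a i * a j / εY + b i * b j / εH := by
    intro i hi j hj hij
    have hc := hcompat i hi j hj hij
    simp only [ha, hb, hεY, hεH]
    have e1 : (p * (Yb i - bY) / g + q * (Hf i - bH) / g) * (p * (Yb j - bY) / g + q * (Hf j - bH) / g) =
        ((p * (Yb i - bY) + q * (Hf i - bH)) * (p * (Yb j - bY) + q * (Hf j - bH))) / (g * g) := by
      field_simp
    have e2 : p * (Yb i - bY) / g * (p * (Yb j - bY) / g) / (p * bY / g) + q * (Hf i - bH) / g * (q * (Hf j - bH) / g) / (q * bH / g) =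
        (g * (p * ((Yb i - bY) * (Yb j - bY)) / bY + q * ((Hf i - bH) * (Hf j - bH)) / bH)) / (g * g) := by
      field_simp
    rw [e1, e2]
    exact div_le_div_of_nonneg_right hc (mul_pos hgpos hgpos).le
  have main := two_coin_pairwise_family_le hεY0 hεH0 hεsum S a b ha0 hb0 hcompat'
  -- G_j = g (1 + a_j + b_j)
  have hG : ∀ j ∈ S, c0 + p * ((1 - s) * y j + s * k j) + q * ((1 - σ) * gc j + σ * h j) = g * (1 + a j + b j) := fun j _ => by
    simp only [ha, hb, hYb, hHf]; field_simp; rw [hgdef]; ring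
  have step1 : ∏ j ∈ S, (c0 + p * ((1 - s) * y j + s * k j) + q * ((1 - σ) * gc j + σ * h j)) = g ^ n * ∏ j ∈ S, (1 + a j + b j) := by
    rw [Finset.prod_congr rfl hG, Finset.prod_mul_distrib, Finset.prod_const, hcardS]
  -- usages: 1 + a_j/εY = Ȳ_j/bY, 1 + b_j/εH = H_j/bH
  have hx : ∀ j ∈ S, 1 + a j / εY = Yb j / bY := fun j _ => by simp only [ha, hεY]; field_simp; ring
  have hyH : ∀ j ∈ S, 1 + b j / εH = Hf j / bH := fun j _ => by simp only [hb, hεH]; field_simp; ring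
  have hpow : ∀ {c : ℝ}, 0 < c → ∀ {U : ℝ}, U ≤ c ^ (n - 1) → U / c ^ n ≤ 1 / c := by
    intro c hc U hU
    rw [div_le_div_iff₀ (pow_pos hc n) hc]
    have e : c ^ n = c ^ (n - 1) * c := by rw [← pow_succ]; congr 1; omega
    rw [e]; have := mul_le_mul_of_nonneg_right hU hc.le; linarith
  have hX : ∏ j ∈ S, (1 + a j / εY) ≤ 1 / bY := by
    rw [Finset.prod_congr rfl hx, Finset.prod_div_distrib, Finset.prod_const, hcardS]; exact hpow hbY0 hBY
  have hYf : ∏ j ∈ S, (1 + b j / εH) ≤ 1 / bH := by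
    rw [Finset.prod_congr rfl hyH, Finset.prod_div_distrib, Finset.prod_const, hcardS]; exact hpow hbH0 hBH
  have step2 : 1 + εY * (∏ j ∈ S, (1 + a j / εY) - 1) + εH * (∏ j ∈ S, (1 + b j / εH) - 1) ≤ (c0 + p + q) / g := by
    have e : (c0 + p + q) / g = 1 + εY * (1 / bY - 1) + εH * (1 / bH - 1) := by
      rw [hεY, hεH]; field_simp; rw [hgdef]; ring
    rw [e]
    have := mul_le_mul_of_nonneg_left hX hεY0.le
    have := mul_le_mul_of_nonneg_left hYf hεH0.le
    nlinarith
  have hgn : 0 ≤ g ^ n := pow_nonneg hgpos.le n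
  calc ∏ j ∈ S, (c0 + p * ((1 - s) * y j + s * k j) + q * ((1 - σ) * gc j + σ * h j))
      = g ^ n * ∏ j ∈ S, (1 + a j + b j) := step1
    _ ≤ g ^ n * ((c0 + p + q) / g) := mul_le_mul_of_nonneg_left (main.trans step2) hgn
    _ = g ^ (n - 1) * (c0 + p + q) := by
        have : g ^ n = g ^ (n - 1) * g := by rw [← pow_succ]; congr 1; omega
        rw [this]; field_simp

set_option maxHeartbeats 400000 in
/-- **(RES0′) FOR EVERY NUMBER OF PETALS ON H-DOMINANT FAMILIES.**  Same setting; instead of pairwise compatibility assume every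
petal is H-dominant: `p·b_H·(Ȳ_j − b_Ȳ) ≤ (c₀ + p b_Ȳ)·(H_j − b_H)` (its H-face excess dominates its Ȳ-face excess at the rate
`(c₀+pb_Ȳ)/(p b_H)`; pure h-petals, leverage dwarfs `y = α₀₀, k = g`, diagonal petals, H-hubs with small `y`, …).  Then under the
two face budgets `∏ G_j ≤ g^(|S|−1)(c₀ + p + q)` for every `|S| ≥ 1`. [this work] -/
theorem res0_Hdominant {κ : Type*} [DecidableEq κ] {τ σ s α00 α01 α11 c0 : ℝ} (hτ0 : 0 < τ) (hτ1 : τ < 1)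
    (hσ0 : 0 ≤ σ) (hσ1 : σ < 1) (hs0 : 0 < s) (hs1 : s ≤ 1) (hα00 : 0 < α00) (h01 : α00 ≤ α01) (h11 : α01 ≤ α11) (hc0 : 0 ≤ c0)
    (S : Finset κ) (hS : S.Nonempty) (y k gc h : κ → ℝ)
    (hy : ∀ j ∈ S, α00 ≤ y j) (hk : ∀ j ∈ S, α01 ≤ k j) (hg : ∀ j ∈ S, α01 ≤ gc j) (hh : ∀ j ∈ S, α11 ≤ h j)
    (hdom : ∀ j ∈ S, τ * (1 - σ) * ((1 - σ) * α01 + σ * α11) * ((1 - s) * y j + s * k j - ((1 - s) * α00 + s * α01)) ≤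
      (c0 + τ * (1 - σ) * ((1 - s) * α00 + s * α01)) * ((1 - σ) * gc j + σ * h j - ((1 - σ) * α01 + σ * α11)))
    (hBY : ∏ j ∈ S, ((1 - s) * y j + s * k j) ≤ ((1 - s) * α00 + s * α01) ^ (S.card - 1))
    (hBH : ∏ j ∈ S, ((1 - σ) * gc j + σ * h j) ≤ ((1 - σ) * α01 + σ * α11) ^ (S.card - 1)) :
    ∏ j ∈ S, (c0 + τ * (1 - σ) * ((1 - s) * y j + s * k j) + s * (1 - τ) * ((1 - σ) * gc j + σ * h j)) ≤
      (c0 + τ * (1 - σ) * ((1 - s) * α00 + s * α01) + s * (1 - τ) * ((1 - σ) * α01 + σ * α11)) ^ (S.card - 1) *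
        (c0 + τ * (1 - σ) + s * (1 - τ)) := by
  have hα01 : 0 < α01 := lt_of_lt_of_le hα00 h01
  have hα11 : 0 < α11 := lt_of_lt_of_le hα01 h11
  have hp0 : 0 < τ * (1 - σ) := mul_pos hτ0 (by linarith)
  have hq0 : 0 < s * (1 - τ) := mul_pos hs0 (by linarith)
  have hbY0 : 0 < (1 - s) * α00 + s * α01 := by nlinarith [mul_nonneg (sub_nonneg.2 hs1) hα00.le, mul_pos hs0 hα01]
  have hbH0 : 0 < (1 - σ) * α01 + σ * α11 := by nlinarith [mul_pos (sub_pos.2 hσ1) hα01, mul_nonneg hσ0 hα11.le]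
  refine res0_pairwise hτ0 hτ1 hσ0 hσ1 hs0 hs1 hα00 h01 h11 hc0 S hS y k gc h hy hk hg hh ?_ hBY hBH
  intro i hi j hj _
  -- abbreviate
  obtain ⟨bY, hbY⟩ : ∃ b, b = (1 - s) * α00 + s * α01 := ⟨_, rfl⟩
  obtain ⟨bH, hbH⟩ : ∃ b, b = (1 - σ) * α01 + σ * α11 := ⟨_, rfl⟩
  obtain ⟨p, hp⟩ : ∃ t, t = τ * (1 - σ) := ⟨_, rfl⟩
  obtain ⟨q, hq⟩ : ∃ t, t = s * (1 - τ) := ⟨_, rfl⟩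
  have hdi := hdom i hi; have hdj := hdom j hj
  rw [← hbY, ← hbH, ← hp] at hdi hdj ⊢
  rw [← hq]
  rw [← hbY] at hbY0; rw [← hbH] at hbH0; rw [← hp] at hp0; rw [← hq] at hq0
  obtain ⟨g, hgdef⟩ : ∃ t, t = c0 + p * bY + q * bH := ⟨_, rfl⟩
  rw [← hgdef]
  have hgpos : 0 < g := by rw [hgdef]; nlinarith [mul_pos hp0 hbY0, mul_pos hq0 hbH0]
  -- excesses (raw): u = ΔȲ ≥ 0, w = ΔH ≥ 0
  obtain ⟨ui, hui⟩ : ∃ t, t = (1 - s) * y i + s * k i - bY := ⟨_, rfl⟩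
  obtain ⟨uj, huj⟩ : ∃ t, t = (1 - s) * y j + s * k j - bY := ⟨_, rfl⟩
  obtain ⟨wi, hwi⟩ : ∃ t, t = (1 - σ) * gc i + σ * h i - bH := ⟨_, rfl⟩
  obtain ⟨wj, hwj⟩ : ∃ t, t = (1 - σ) * gc j + σ * h j - bH := ⟨_, rfl⟩
  rw [← hui, ← huj, ← hwi, ← hwj]
  rw [← hui, ← hwi] at hdi; rw [← huj, ← hwj] at hdj
  have hui0 : 0 ≤ ui := by
    rw [hui, hbY]; nlinarith [mul_le_mul_of_nonneg_left (hy i hi) (sub_nonneg.2 hs1), mul_le_mul_of_nonneg_left (hk i hi) hs0.le]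
  have huj0 : 0 ≤ uj := by
    rw [huj, hbY]; nlinarith [mul_le_mul_of_nonneg_left (hy j hj) (sub_nonneg.2 hs1), mul_le_mul_of_nonneg_left (hk j hj) hs0.le]
  -- normalised: a = p u/g, b = q w/g, εY = p bY/g, εH = q bH/g; H-dominance is εH a ≤ (1-εH) b
  have hεY0 : 0 < p * bY / g := div_pos (mul_pos hp0 hbY0) hgpos
  have hεH0 : 0 < q * bH / g := div_pos (mul_pos hq0 hbH0) hgpos
  have hεsum : p * bY / g + q * bH / g ≤ 1 := by rw [← add_div, div_le_one hgpos, hgdef]; linarith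
  have h1mH : 1 - q * bH / g = (c0 + p * bY) / g := by field_simp; rw [hgdef]; ring
  have hdi' : q * bH / g * (p * ui / g) ≤ (1 - q * bH / g) * (q * wi / g) := by
    rw [h1mH, show q * bH / g * (p * ui / g) = q * (p * bH * ui) / (g * g) by field_simp,
      show (c0 + p * bY) / g * (q * wi / g) = q * ((c0 + p * bY) * wi) / (g * g) by field_simp]
    exact div_le_div_of_nonneg_right (mul_le_mul_of_nonneg_left hdi hq0.le) (mul_pos hgpos hgpos).le
  have hdj' : q * bH / g * (p * uj / g) ≤ (1 - q * bH / g) * (q * wj / g) := by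
    rw [h1mH, show q * bH / g * (p * uj / g) = q * (p * bH * uj) / (g * g) by field_simp,
      show (c0 + p * bY) / g * (q * wj / g) = q * ((c0 + p * bY) * wj) / (g * g) by field_simp]
    exact div_le_div_of_nonneg_right (mul_le_mul_of_nonneg_left hdj hq0.le) (mul_pos hgpos hgpos).le
  have key := compat_of_Hdominant hεY0 hεH0 hεsum (div_nonneg (mul_nonneg hp0.le hui0) hgpos.le)
    (div_nonneg (mul_nonneg hp0.le huj0) hgpos.le) hdi' hdj'
  -- translate back (× g²)
  have e1 : (p * ui / g + q * wi / g) * (p * uj / g + q * wj / g) = ((p * ui + q * wi) * (p * uj + q * wj)) / (g * g) := by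
    field_simp
  have e2 : p * ui / g * (p * uj / g) / (p * bY / g) + q * wi / g * (q * wj / g) / (q * bH / g) =
      (g * (p * (ui * uj) / bY + q * (wi * wj) / bH)) / (g * g) := by
    field_simp
  rw [e1, e2, div_le_div_iff_of_pos_right (mul_pos hgpos hgpos)] at key
  exact key

end Summit.CriticalPhenomena.PercolationContinuityZ3.Theorems.SunflowerPartition.SafeCalc.LinkedCurrency
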